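import Literature.Geometry.Symplectic.GromovR4StdModel

/-!
# The Liouville collar is symplectic: `Ψ^*λ₀ = α` along the rays

Helper file of stub `stub_liouvilleCollar` (line `kaehler-jacket`, crux stmt-SmoothPoincare4-7823).
This is the heart of Geiges (2008), Lemma 5.2.4: the collar map
`Ψ(φ^Z_t(x_θ)) = e^{t/2} e^{u(θ)/2} θ` pulls `λ₀ = ½ ω₀(y, dy)` back to `α`, because both
`1`-forms vanish on the Liouville field, satisfy `L_Z β = β`, and agree along the hypersurface.
We run the argument on the *source* side of the
flow box, where the Liouville field is the Euler field `z` and its flow is the explicit dilation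
`s ↦ s z` — so no variational equation is needed.  Abstractly: `G` (the star map), `Λ` (the
flow-out map), `F` (the jacket in the chart), `a` (the `1`-form `α` in the chart, as a map
`ℝ⁴ → (ℝ⁴ →L ℝ)`), `V` (the Liouville field) are given with their pointwise identities on the
logarithmic shell `O_ε = {e^{-ε} < ‖z‖ < e^{ε}}`, and we prove
`ω₀(DG v, DG w) = ω₀(D(F ∘ Λ) v, D(F ∘ Λ) w)` on `O_ε` (`helper_kjCollarForms`):

* the `1`-form `β = G^*λ₀ − Λ^*a` (`βG z = ½ ω₀(G z, DG_z ·)`, `βA z = a(Λ z) ∘ DΛ_z`) has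
  antisymmetrised derivative `dβ(v, w) = ω₀(DG v, DG w) − ω₀(DF DΛ v, DF DΛ w)` (chain rule,
  symmetry of second derivatives, `da = F^*ω₀`: `antisym_fderiv_pullbackForm`);
* `β_z(z) = 0` and `dβ_z(z, w) = 2 β_z(w)` (Euler identities `DG_z z = G z`, `DΛ_z z = 2V`, and
  `ω₀(DF V, DF ·) = a`), whence `Dβ_z(z)(w) = β_z(w)` (Leibniz rule for `z ↦ β_z(z) ≡ 0`);
* `β = 0` on the unit sphere (the contact condition `a|_{TS} = e^{u} α₀` against
  `ω₀(G θ, DG_θ w) = e^{u θ} ω₀(θ, w)`);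
* along each ray `g(s) = β_{sθ}(w₀)` satisfies `s g' = g`, `g(1) = 0`, so `g ≡ 0`
  (`eq_zero_of_ray_ode`); hence `β ≡ 0` on `O_ε`, `dβ = 0`, which is the claim.

## References

* H. Geiges, *An Introduction to Contact Topology*, CUP 2008, Lemma 5.2.4 and
  Lemma/Definition 1.4.5. [Geiges2008]
-/

noncomputable section

set_option linter.dupNamespace false

open scoped Manifold ContDiff Topology
open Set Function Metric
open Literature.Geometry.Symplectic (stdSymplecticForm stdSymplecticBilin stdSymplecticBilin_apply
  stdSymplecticForm_self stdSymplecticForm_swap)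

namespace Summit.SmoothPoincare4.SmoothPoincare4.Theorems.Target.KaehlerJacket

/-- Model space `ℝ⁴ = ℂ²`. -/
local notation "E4" => EuclideanSpace ℝ (Fin 4)

/-! ### Calculus of `1`-forms `ℝ⁴ → (ℝ⁴ →L ℝ)` -/

section Calculus

variable {b : E4 → E4 →L[ℝ] ℝ} {f : E4 → E4} {z : E4}

/-- **Derivative of a pulled-back `1`-form** `y ↦ b(f y) ∘ Df_y` (chain rule and Leibniz rule for
the composition of operator-valued maps). [folklore] -/
theorem hasFDerivAt_pullbackForm (hf : ContDiffAt ℝ ∞ f z) (hb : DifferentiableAt ℝ b (f z)) :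
    HasFDerivAt (fun y => (b (f y)).comp (fderiv ℝ f y))
      ((ContinuousLinearMap.compL ℝ E4 E4 ℝ (b (f z))).comp (fderiv ℝ (fderiv ℝ f) z) +
        ((ContinuousLinearMap.compL ℝ E4 E4 ℝ).flip (fderiv ℝ f z)).comp
          ((fderiv ℝ b (f z)).comp (fderiv ℝ f z))) z := by
  have hc : HasFDerivAt (fun y => b (f y)) ((fderiv ℝ b (f z)).comp (fderiv ℝ f z)) z :=
    hb.hasFDerivAt.comp z (hf.differentiableAt (by simp)).hasFDerivAt
  have hd : HasFDerivAt (fderiv ℝ f) (fderiv ℝ (fderiv ℝ f) z) z :=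
    ((hf.fderiv_right (m := 1) (by norm_cast)).differentiableAt one_ne_zero).hasFDerivAt
  exact hc.clm_comp hd

/-- **The antisymmetrised derivative of a pulled-back `1`-form**: the second-derivative terms
cancel (symmetry of `D²f`), leaving `Db_{f z}(Df v)(Df w) − Db_{f z}(Df w)(Df v)` — naturality of
the exterior derivative of `1`-forms. [folklore] -/
theorem antisym_fderiv_pullbackForm (hf : ContDiffAt ℝ ∞ f z) (hb : DifferentiableAt ℝ b (f z))
    (v w : E4) :
    fderiv ℝ (fun y => (b (f y)).comp (fderiv ℝ f y)) z v w -
        fderiv ℝ (fun y => (b (f y)).comp (fderiv ℝ f y)) z w v =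
      fderiv ℝ b (f z) (fderiv ℝ f z v) (fderiv ℝ f z w) -
        fderiv ℝ b (f z) (fderiv ℝ f z w) (fderiv ℝ f z v) := by
  rw [(hasFDerivAt_pullbackForm hf hb).fderiv]
  have hsymm : fderiv ℝ (fderiv ℝ f) z v w = fderiv ℝ (fderiv ℝ f) z w v :=
    (hf.isSymmSndFDerivAt (by
      rw [minSmoothness_of_isRCLikeNormedField]; exact WithTop.coe_le_coe.2 le_top)).eq v w
  simp only [add_apply, ContinuousLinearMap.coe_comp, Function.comp_apply,
    ContinuousLinearMap.compL_apply, ContinuousLinearMap.flip_apply, hsymm]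
  ring

/-- The pulled-back form is differentiable. [folklore] -/
theorem differentiableAt_pullbackForm (hf : ContDiffAt ℝ ∞ f z) (hb : DifferentiableAt ℝ b (f z)) :
    DifferentiableAt ℝ (fun y => (b (f y)).comp (fderiv ℝ f y)) z :=
  (hasFDerivAt_pullbackForm hf hb).differentiableAt

variable {β : E4 → E4 →L[ℝ] ℝ}

/-- Leibniz rule for `y ↦ β_y(y)`. [folklore] -/
theorem hasFDerivAt_apply_self (hβ : DifferentiableAt ℝ β z) :
    HasFDerivAt (fun y => β y y) (β z + (fderiv ℝ β z).flip z) z := by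
  have h := hβ.hasFDerivAt.clm_apply (hasFDerivAt_id z)
  simp only [id_eq, ContinuousLinearMap.comp_id] at h
  exact h

/-- Derivative of `y ↦ β_y(w₀)` for a fixed vector `w₀`. [folklore] -/
theorem hasFDerivAt_apply_const (hβ : DifferentiableAt ℝ β z) (w₀ : E4) :
    HasFDerivAt (fun y => β y w₀) ((fderiv ℝ β z).flip w₀) z := by
  have h := hβ.hasFDerivAt.clm_apply (hasFDerivAt_const w₀ z)
  simp only [ContinuousLinearMap.comp_zero, zero_add] at h
  exact h

end Calculus

/-- **The Euler equation along a ray.** If `s g'(s) = g(s)` on an interval `(a, b) ∋ 1` with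
`a > 0` and `g(1) = 0`, then `g ≡ 0` there (`(g/s)' = 0`). [folklore] -/
theorem eq_zero_of_ray_ode {g g' : ℝ → ℝ} {a b : ℝ} (ha : 0 < a) (h1 : (1 : ℝ) ∈ Ioo a b)
    (hg : ∀ s ∈ Ioo a b, HasDerivAt g (g' s) s) (hode : ∀ s ∈ Ioo a b, s * g' s = g s)
    (hg1 : g 1 = 0) : ∀ s ∈ Ioo a b, g s = 0 := by
  have hq : ∀ s ∈ Ioo a b, HasDerivAt (fun s => s⁻¹ * g s) 0 s := by
    intro s hs
    have hs0 : s ≠ 0 := (ha.trans hs.1).ne'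
    have h := (hasDerivAt_inv hs0).mul (hg s hs)
    have hval : -(s ^ 2)⁻¹ * g s + s⁻¹ * g' s = 0 := by
      rw [← hode s hs]
      field_simp
      ring
    rw [hval] at h
    exact h
  intro s hs
  have hconst := isOpen_Ioo.is_const_of_deriv_eq_zero isPreconnected_Ioo
    (fun s hs => (hq s hs).differentiableAt.differentiableWithinAt)
    (fun s hs => (hq s hs).deriv) hs h1
  simp only [hg1, inv_one, mul_zero, mul_eq_zero, inv_eq_zero] at hconst
  rcases hconst with h | h
  · exact absurd h (ha.trans hs.1).ne'
  · exact h

/-! ### The main identity -/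

/-- **`G^*ω₀ = (F ∘ Λ)^*ω₀` on the flow box** (`helper_kjCollarForms`; Geiges 2008, proof of
Lemma 5.2.4: `Ψ^*λ = α`, differentiated).  On the logarithmic shell `O_ε`, given: the star map `G`
(smooth, `DG_z z = G z`, and `ω₀(G θ, DG_θ w) = e^{u θ} ω₀(θ, w)` for unit `θ ⊥ w`); the flow-out
map `Λ` (smooth, `DΛ_z z = 2 V(Λ z)`, `Λ θ = c + μ A θ` and `DΛ_θ w = μ A w` on the unit sphere);
the jacket `F` and the `1`-form `a` smooth at the points `Λ z` with the Liouville duality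
`ω₀(DF V, DF w) = a(w)` and the primitive identity `da = F^*ω₀` there; and the contact condition
`a_{c + μAθ}(μ A w) = e^{u θ} ½ ω₀(θ, w)` for unit `θ ⊥ w`.  Then
`ω₀(DG_z v, DG_z w) = ω₀(DF DΛ_z v, DF DΛ_z w)` for `z ∈ O_ε`. [cite: Geiges2008, Lemma 5.2.4] -/
theorem helper_kjCollarForms :
    ∀ (ε μ : ℝ) (c : E4) (A : E4 ≃ₗᵢ[ℝ] E4) (u : E4 → ℝ) (G Λ F V : E4 → E4)
      (a : E4 → E4 →L[ℝ] ℝ), 0 < ε → 0 < μ →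
      (∀ z : E4, z ≠ 0 → ContDiffAt ℝ ∞ G z ∧ fderiv ℝ G z z = G z) →
      (∀ z : E4, ‖z‖ = 1 → ∀ w : E4, inner ℝ w z = 0 →
        stdSymplecticForm (G z) (fderiv ℝ G z w) = Real.exp (u z) * stdSymplecticForm z w) →
      (∀ z : E4, Real.exp (-ε) < ‖z‖ → ‖z‖ < Real.exp ε →
        ContDiffAt ℝ ∞ Λ z ∧ fderiv ℝ Λ z z = (2 : ℝ) • V (Λ z) ∧
        ContDiffAt ℝ ∞ F (Λ z) ∧ ContDiffAt ℝ ∞ a (Λ z) ∧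
        (∀ w : E4, stdSymplecticForm (fderiv ℝ F (Λ z) (V (Λ z))) (fderiv ℝ F (Λ z) w) =
          a (Λ z) w) ∧
        (∀ v w : E4, fderiv ℝ a (Λ z) v w - fderiv ℝ a (Λ z) w v =
          stdSymplecticForm (fderiv ℝ F (Λ z) v) (fderiv ℝ F (Λ z) w))) →
      (∀ z : E4, ‖z‖ = 1 → Λ z = c + μ • A z ∧
        ∀ w : E4, inner ℝ w z = 0 → fderiv ℝ Λ z w = μ • A w) →
      (∀ z : E4, ‖z‖ = 1 → ∀ w : E4, inner ℝ w z = 0 →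
        a (c + μ • A z) (μ • A w) = Real.exp (u z) * (1 / 2 * stdSymplecticForm z w)) →
      ∀ z : E4, Real.exp (-ε) < ‖z‖ → ‖z‖ < Real.exp ε → ∀ v w : E4,
        stdSymplecticForm (fderiv ℝ G z v) (fderiv ℝ G z w) =
          stdSymplecticForm (fderiv ℝ F (Λ z) (fderiv ℝ Λ z v))
            (fderiv ℝ F (Λ z) (fderiv ℝ Λ z w)) := by
  intro ε μ c A u G Λ F V a hε hμ hG hGsph hΛ hΛsph htext
  -- the shell
  set O : Set E4 := {z : E4 | Real.exp (-ε) < ‖z‖ ∧ ‖z‖ < Real.exp ε} with hO_def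
  have hO : IsOpen O := isOpen_Ioo.preimage continuous_norm
  have hOpos : ∀ z ∈ O, 0 < ‖z‖ := fun z hz => lt_trans (Real.exp_pos _) hz.1
  have hO0 : ∀ z ∈ O, z ≠ 0 := fun z hz => norm_ne_zero_iff.1 (hOpos z hz).ne'
  have hO1 : ∀ z : E4, ‖z‖ = 1 → z ∈ O := fun z hz =>
    ⟨by rw [hz]; exact Real.exp_lt_one_iff.2 (by linarith),
      by rw [hz]; exact Real.one_lt_exp_iff.2 hε⟩
  -- the two `1`-forms
  set lam : E4 →L[ℝ] E4 →L[ℝ] ℝ := (1 / 2 : ℝ) • stdSymplecticBilin with hlam_def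
  have hlam : ∀ v w : E4, lam v w = 1 / 2 * stdSymplecticForm v w := fun v w => by
    simp only [hlam_def, smul_apply, stdSymplecticBilin_apply, smul_eq_mul]
  set βG : E4 → E4 →L[ℝ] ℝ := fun y => (lam (G y)).comp (fderiv ℝ G y) with hβG_def
  set βA : E4 → E4 →L[ℝ] ℝ := fun y => (a (Λ y)).comp (fderiv ℝ Λ y) with hβA_def
  set β : E4 → E4 →L[ℝ] ℝ := fun y => βG y - βA y with hβ_def
  have hβ_apply : ∀ y w : E4, β y w =
      1 / 2 * stdSymplecticForm (G y) (fderiv ℝ G y w) - a (Λ y) (fderiv ℝ Λ y w) := by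
    intro y w
    simp only [hβ_def, hβG_def, hβA_def, sub_apply, ContinuousLinearMap.coe_comp,
      Function.comp_apply, hlam]
  -- differentiability on the shell
  have hdG : ∀ z ∈ O, DifferentiableAt ℝ βG z := fun z hz =>
    differentiableAt_pullbackForm (b := fun y => lam y) (hG z (hO0 z hz)).1 lam.differentiableAt
  have hdA : ∀ z ∈ O, DifferentiableAt ℝ βA z := fun z hz =>
    differentiableAt_pullbackForm (hΛ z hz.1 hz.2).1
      ((hΛ z hz.1 hz.2).2.2.2.1.differentiableAt (by simp))
  have hβd : ∀ z ∈ O, DifferentiableAt ℝ β z := fun z hz => (hdG z hz).sub (hdA z hz)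
  -- (E) the antisymmetrised derivative of `β`
  have hE : ∀ z ∈ O, ∀ v w : E4, fderiv ℝ β z v w - fderiv ℝ β z w v =
      stdSymplecticForm (fderiv ℝ G z v) (fderiv ℝ G z w) -
        stdSymplecticForm (fderiv ℝ F (Λ z) (fderiv ℝ Λ z v))
          (fderiv ℝ F (Λ z) (fderiv ℝ Λ z w)) := by
    intro z hz v w
    obtain ⟨hΛs, -, -, has, -, hprim⟩ := hΛ z hz.1 hz.2
    have h1 := antisym_fderiv_pullbackForm (b := fun y => lam y) (hG z (hO0 z hz)).1
      lam.differentiableAt v w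
    rw [show (fderiv ℝ (fun y => lam y) (G z)) = lam from lam.fderiv, hlam, hlam,
      stdSymplecticForm_swap (fderiv ℝ G z v)] at h1
    have h2 := antisym_fderiv_pullbackForm (b := a) hΛs (has.differentiableAt (by simp)) v w
    rw [hprim] at h2
    have hsub : fderiv ℝ β z = fderiv ℝ βG z - fderiv ℝ βA z :=
      fderiv_fun_sub (hdG z hz) (hdA z hz)
    rw [hsub]
    simp only [sub_apply]
    rw [hβG_def, hβA_def] at *
    linarith [h1, h2]
  -- (i') `β_z(z) = 0`
  have hself : ∀ z ∈ O, β z z = 0 := by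
    intro z hz
    obtain ⟨-, hΛself, -, -, hdual, -⟩ := hΛ z hz.1 hz.2
    rw [hβ_apply, (hG z (hO0 z hz)).2, stdSymplecticForm_self, mul_zero, zero_sub, hΛself,
      map_smul, smul_eq_mul, ← hdual, stdSymplecticForm_self, mul_zero, neg_zero]
  -- (ii') `dβ_z(z, w) = 2 β_z(w)`
  have hii : ∀ z ∈ O, ∀ w : E4, fderiv ℝ β z z w - fderiv ℝ β z w z = 2 * β z w := by
    intro z hz w
    obtain ⟨-, hΛself, -, -, hdual, -⟩ := hΛ z hz.1 hz.2
    rw [hE z hz, (hG z (hO0 z hz)).2, hΛself, map_smul, hβ_apply, ← hdual (fderiv ℝ Λ z w)]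
    simp only [← stdSymplecticBilin_apply, map_smul, smul_apply, smul_eq_mul]
    ring
  -- Leibniz: `β_z(v) + Dβ_z(v)(z) = 0`
  have hL : ∀ z ∈ O, ∀ v : E4, β z v + fderiv ℝ β z v z = 0 := by
    intro z hz v
    have hk := hasFDerivAt_apply_self (hβd z hz)
    have hzero : (fun y => β y y) =ᶠ[𝓝 z] fun _ => (0 : ℝ) := by
      filter_upwards [hO.mem_nhds hz] with y hy
      exact hself y hy
    have hk0 : β z + (fderiv ℝ β z).flip z = 0 := by
      rw [← hk.fderiv, hzero.fderiv_eq, fderiv_const_apply]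
    have := congrArg (fun L : E4 →L[ℝ] ℝ => L v) hk0
    simpa only [add_apply, ContinuousLinearMap.flip_apply, zero_apply] using this
  -- the radial derivative: `Dβ_z(z)(w) = β_z(w)`
  have hrad : ∀ z ∈ O, ∀ w : E4, fderiv ℝ β z z w = β z w := by
    intro z hz w
    have h1 := hii z hz w
    have h2 := hL z hz w
    linarith
  -- (iii') `β = 0` on the unit sphere
  have hsph : ∀ z : E4, ‖z‖ = 1 → ∀ w : E4, β z w = 0 := by
    intro z hz w
    have hzO : z ∈ O := hO1 z hz
    obtain ⟨hΛz, hΛtan⟩ := hΛsph z hz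
    -- decompose `w = ⟪w, θ⟫ θ + w⊥`
    set t : ℝ := inner ℝ w z with ht
    set wp : E4 := w - t • z with hwp
    have hwpz : inner ℝ wp z = 0 := by
      rw [hwp, inner_sub_left, real_inner_smul_left, real_inner_self_eq_norm_sq, hz, one_pow,
        mul_one, sub_self]
    have hwdec : w = t • z + wp := by rw [hwp, add_sub_cancel]
    have hperp : β z wp = 0 := by
      rw [hβ_apply, hGsph z hz wp hwpz, hΛz, hΛtan wp hwpz, htext z hz wp hwpz]
      ring
    rw [hwdec, map_add, map_smul, hself z hzO, hperp, smul_zero, add_zero]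
  -- along the rays: `β_{sθ}(w₀) = 0`
  have hray : ∀ θ : E4, ‖θ‖ = 1 → ∀ w₀ : E4, ∀ s ∈ Ioo (Real.exp (-ε)) (Real.exp ε),
      β (s • θ) w₀ = 0 := by
    intro θ hθ w₀
    have hmem : ∀ s ∈ Ioo (Real.exp (-ε)) (Real.exp ε), s • θ ∈ O := by
      intro s hs
      have hs0 : 0 < s := lt_trans (Real.exp_pos _) hs.1
      show Real.exp (-ε) < ‖s • θ‖ ∧ ‖s • θ‖ < Real.exp ε
      rw [norm_smul, Real.norm_of_nonneg hs0.le, hθ, mul_one]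
      exact hs
    refine eq_zero_of_ray_ode (g := fun s => β (s • θ) w₀)
      (g' := fun s => fderiv ℝ β (s • θ) θ w₀) (Real.exp_pos _) ?_ ?_ ?_ ?_
    · exact ⟨Real.exp_lt_one_iff.2 (by linarith), Real.one_lt_exp_iff.2 hε⟩
    · intro s hs
      have h := (hasFDerivAt_apply_const (hβd _ (hmem s hs)) w₀).comp_hasDerivAt s
        ((hasDerivAt_id s).smul_const θ)
      simpa only [one_smul, ContinuousLinearMap.flip_apply, Function.comp_def, id_eq] using h
    · intro s hs
      have h := hrad _ (hmem s hs) w₀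
      rw [map_smul, smul_apply, smul_eq_mul] at h
      exact h
    · show β ((1 : ℝ) • θ) w₀ = 0
      rw [one_smul]
      exact hsph θ hθ w₀
  -- hence `β = 0` on the shell, and so is its derivative
  have hzeroO : ∀ z ∈ O, β z = 0 := by
    intro z hz
    ext w
    have hz0 := hO0 z hz
    have hunit : ‖‖z‖⁻¹ • z‖ = 1 := by
      rw [norm_smul, norm_inv, norm_norm, inv_mul_cancel₀ (norm_ne_zero_iff.2 hz0)]
    have h := hray (‖z‖⁻¹ • z) hunit w ‖z‖ hz
    rw [smul_smul, mul_inv_cancel₀ (norm_ne_zero_iff.2 hz0), one_smul] at h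
    rw [h, zero_apply]
  intro z hz1 hz2 v w
  have hz : z ∈ O := ⟨hz1, hz2⟩
  have hfd : fderiv ℝ β z = 0 := by
    have hev : β =ᶠ[𝓝 z] fun _ => (0 : E4 →L[ℝ] ℝ) := by
      filter_upwards [hO.mem_nhds hz] with y hy
      exact hzeroO y hy
    rw [hev.fderiv_eq, fderiv_const_apply]
  have h := hE z hz v w
  rw [hfd] at h
  simp only [zero_apply, sub_self] at h
  linarith

end Summit.SmoothPoincare4.SmoothPoincare4.Theorems.Target.KaehlerJacket

end
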